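import Summits.CriticalPhenomena.SAWScalingLimit.Theorems.SAWLoopFugacityFlowAvoidanceLimitFominSwap
import Literature.Probability.LatticeModels.RandomWalkLoopMeasure
import HarnessLib

/-!
# Fomin's inequality for walk-sum Green's functions (line `symplectic-fermion-anchor`, crux
`SAWLoopFugacityFlow.AvoidanceLimit`, stmt-CriticalPhenomena-10649; brick F2 of the (CR) toolbox)

The free direction of the `2 × 2` cross-ratio bound for the Green's function
`G_A(a, b) = ∑_{ω : a → b} (1/4)^{|ω|}` (`rwGreen`) of the simple random walk killed off a subgraph
`G` of `ℤ²`: if EVERY pair of walks `(γ : a₁ → b₂, γ' : a₂ → b₁)` is such that `γ'` meets the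
chronological loop erasure `LE(γ)`, then

`G(a₁, b₂) G(a₂, b₁) ≤ G(a₁, b₁) G(a₂, b₂)`.

This is the inequality half of Fomin's determinant identity (Fomin 2001; Lawler–Limic 2010, §9.5,
Prop. 9.5.1): `det [G(aᵢ, bⱼ)]` is the weight of the pairs `(γ₁ : a₁ → b₁, γ₂ : a₂ → b₂)` with
`γ₂ ∩ LE(γ₁) = ∅` minus the weight of the pairs `(γ : a₁ → b₂, γ' : a₂ → b₁)` with
`γ' ∩ LE(γ) = ∅`, and the hypothesis kills the second term. Proof: Fomin's tail swap `Φ`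
(`exists_fominSwap`, brick F1) applied to the pair of supports is, by hypothesis, defined on all
pairs `(γ, γ')`; its image is a pair of `G.Adj`-chains `a₁ → b₁`, `a₂ → b₂` with the same total
number of steps, i.e. (Mathlib's `Walk.ofSupport` / `Walk.ext_support`) a pair of walks of the same
total weight, and the resulting map `Ψ` on pairs of walks is injective because `Φ` is an involution
on its domain. Reindexing the double series along `Ψ` (`ENNReal.tsum_comp_le_tsum_of_injective`)
gives the bound. No planarity is used here: planarity enters only through the hypothesis.

Sources: S. Fomin, Trans. AMS 353 (2001) 3563–3583 [Fomin2001]; G. F. Lawler, V. Limic,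
*Random Walk: A Modern Introduction* (2010), §9.5 [LawlerLimic2010]; G. F. Lawler, Probab. Surveys
15 (2018), §2 (the Green's function as a walk sum) [Lawler2018]. No definitions.
-/

noncomputable section

open scoped ENNReal
open Literature.Probability.RandomPlanarGeometry Literature.Probability.LatticeModels

namespace Summit.CriticalPhenomena.SAWScalingLimit.Theorems.AvoidanceLimit.Anchor

/-! ### Walk sums: products and supports -/

/-- The product of two walk-sum Green's functions is the sum over PAIRS of walks of the product
weight `(1/4)^{|ω| + |ω'|}` (unconditionally, in `ℝ≥0∞`). [cite: Lawler2018, §2 (Green's function)] -/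
theorem rwGreen_mul_rwGreen_eq_tsum_prod (G : SimpleGraph (Site 2)) (a b c d : Site 2) :
    rwGreen G a b * rwGreen G c d =
      ∑' p : G.Walk a b × G.Walk c d, ((1 : ℝ≥0∞) / 4) ^ (p.1.length + p.2.length) := by
  unfold rwGreen
  rw [ENNReal.tsum_prod', ← ENNReal.tsum_mul_right]
  refine tsum_congr fun ω => ?_
  rw [← ENNReal.tsum_mul_left]
  exact tsum_congr fun ω' => (pow_add _ _ _).symm

/-- A `G.Adj`-chain from `a` to `b` is the support of a walk from `a` to `b` (Mathlib's
`Walk.ofSupport`, transported along the endpoint identifications). [folklore] -/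
theorem exists_walk_support_eq {V : Type*} (G : SimpleGraph V) (l : List V) (a b : V)
    (hc : List.IsChain G.Adj l) (ha : l.head? = some a) (hb : l.getLast? = some b) :
    ∃ w : G.Walk a b, w.support = l := by
  have hne : l ≠ [] := by
    rintro rfl
    simp at ha
  have ha' : l.head hne = a := by
    rw [List.head?_eq_some_head hne, Option.some_inj] at ha
    exact ha
  have hb' : l.getLast hne = b := by
    rw [List.getLast?_eq_some_getLast hne, Option.some_inj] at hb
    exact hb
  exact ⟨(SimpleGraph.Walk.ofSupport l hne hc).copy ha' hb', by
    rw [SimpleGraph.Walk.support_copy, SimpleGraph.Walk.support_ofSupport]⟩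

/-! ### Fomin's inequality -/

/-- **F2: Fomin's inequality — the free direction of the cross-ratio bound for walk-sum Green's
functions.** For the simple random walk killed off a subgraph `G` of `ℤ²`, if every pair of walks
`(γ : a₁ → b₂, γ' : a₂ → b₁)` has `γ'` meeting the chronological loop erasure `LE(γ)`, then
`G(a₁, b₂) G(a₂, b₁) ≤ G(a₁, b₁) G(a₂, b₂)`: Fomin's tail swap (`exists_fominSwap`) induces a
weight-preserving injection from the pairs `(a₁ → b₂, a₂ → b₁)` into the pairs
`(a₁ → b₁, a₂ → b₂)` (the inequality half of Fomin's `2 × 2` determinant identity).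
[cite: LawlerLimic2010, §9.5] -/
theorem rwGreen_mul_le_of_loopErase_meets :
    ∀ (G : SimpleGraph (Site 2)) (a₁ a₂ b₁ b₂ : Site 2),
      (∀ (γ : G.Walk a₁ b₂) (γ' : G.Walk a₂ b₁), ∃ z ∈ γ'.support, z ∈ loopErase γ.support) →
      rwGreen G a₁ b₂ * rwGreen G a₂ b₁ ≤ rwGreen G a₁ b₁ * rwGreen G a₂ b₂ := by
  intro G a₁ a₂ b₁ b₂ hmeet
  obtain ⟨Φ, hΦ⟩ := exists_fominSwap
  -- supports of walks start and end at the endpoints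
  have hhead : ∀ {a b : Site 2} (w : G.Walk a b), w.support.head? = some a := fun w => by
    rw [List.head?_eq_some_head w.support_ne_nil, SimpleGraph.Walk.head_support]
  have hlast : ∀ {a b : Site 2} (w : G.Walk a b), w.support.getLast? = some b := fun w => by
    rw [List.getLast?_eq_some_getLast w.support_ne_nil, SimpleGraph.Walk.getLast_support]
  -- the tail swap of the supports of a pair `(γ : a₁ → b₂, γ' : a₂ → b₁)` is the pair of supports
  -- of a pair of walks `(a₁ → b₁, a₂ → b₂)`
  have key : ∀ p : G.Walk a₁ b₂ × G.Walk a₂ b₁, ∃ q : G.Walk a₁ b₁ × G.Walk a₂ b₂,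
      q.1.support = (Φ (p.1.support, p.2.support)).1 ∧
        q.2.support = (Φ (p.1.support, p.2.support)).2 := by
    intro p
    obtain ⟨-, -, -, h1, h2, h3, h4, -, hchain⟩ := hΦ p.1.support p.2.support (hmeet p.1 p.2)
    obtain ⟨hc1, hc2⟩ := hchain G.Adj p.1.isChain_adj_support p.2.isChain_adj_support
    obtain ⟨w₁, hw₁⟩ := exists_walk_support_eq G _ a₁ b₁ hc1 (h1.trans (hhead p.1))
      (h3.trans (hlast p.2))
    obtain ⟨w₂, hw₂⟩ := exists_walk_support_eq G _ a₂ b₂ hc2 (h2.trans (hhead p.2))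
      (h4.trans (hlast p.1))
    exact ⟨(w₁, w₂), hw₁, hw₂⟩
  choose Ψ hΨ1 hΨ2 using key
  -- `Ψ` is injective since `Φ` is an involution on its domain
  have hinj : Function.Injective Ψ := by
    intro p q hpq
    have hp := (hΦ p.1.support p.2.support (hmeet p.1 p.2)).2.1
    have hq := (hΦ q.1.support q.2.support (hmeet q.1 q.2)).2.1
    have e : Φ (p.1.support, p.2.support) = Φ (q.1.support, q.2.support) :=
      Prod.ext (by rw [← hΨ1 p, ← hΨ1 q, hpq]) (by rw [← hΨ2 p, ← hΨ2 q, hpq])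
    have e' : (p.1.support, p.2.support) = (q.1.support, q.2.support) := by
      rw [← hp, e, hq]
    obtain ⟨e1, e2⟩ := Prod.mk.inj e'
    exact Prod.ext (SimpleGraph.Walk.ext_support e1) (SimpleGraph.Walk.ext_support e2)
  -- `Ψ` preserves the total number of steps, hence the weight
  have hlen : ∀ p, (Ψ p).1.length + (Ψ p).2.length = p.1.length + p.2.length := by
    intro p
    have h := (hΦ p.1.support p.2.support (hmeet p.1 p.2)).2.2.1
    rw [← hΨ1 p, ← hΨ2 p, SimpleGraph.Walk.length_support, SimpleGraph.Walk.length_support,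
      SimpleGraph.Walk.length_support, SimpleGraph.Walk.length_support] at h
    omega
  -- reindex the double series along `Ψ`
  rw [rwGreen_mul_rwGreen_eq_tsum_prod, rwGreen_mul_rwGreen_eq_tsum_prod]
  calc ∑' p : G.Walk a₁ b₂ × G.Walk a₂ b₁, ((1 : ℝ≥0∞) / 4) ^ (p.1.length + p.2.length)
      = ∑' p : G.Walk a₁ b₂ × G.Walk a₂ b₁,
          ((1 : ℝ≥0∞) / 4) ^ ((Ψ p).1.length + (Ψ p).2.length) :=
        tsum_congr fun p => by rw [hlen]
    _ ≤ ∑' q : G.Walk a₁ b₁ × G.Walk a₂ b₂, ((1 : ℝ≥0∞) / 4) ^ (q.1.length + q.2.length) :=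
        ENNReal.tsum_comp_le_tsum_of_injective hinj
          (fun q : G.Walk a₁ b₁ × G.Walk a₂ b₂ => ((1 : ℝ≥0∞) / 4) ^ (q.1.length + q.2.length))

end Summit.CriticalPhenomena.SAWScalingLimit.Theorems.AvoidanceLimit.Anchor

end
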